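import Literature.MathematicalPhysics.QuantumLattice.HubbardCorrelatorCertificateAffine
import Literature.Analysis.FunctionSpaces.LiebWuEnergyDerivative
import HarnessLib

/-!
# The double occupancy of the half-filled Hubbard chain: torus-limit ground states vs. Lieb–Wu

Family `hubbard` (topic `MathematicalPhysics/QuantumLattice`). For every torus-limit ground state
`ω` of the half-filled Hubbard chain (`t = 1`, `U > 0`; `InfVolFermionState.IsTorusLimitOf` of
normalised `N = L` ring ground states along `L → ∞`) the local double occupancy
`D_ω = Re ω(n_{0↑} n_{0↓})` is a supergradient of the concave chain energy density `U ↦ e(1,U)`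
(`IsTorusLimitOf.hubbardChainEnergyDensity_sub_le_mul_re_expect_docc`,
`HubbardCorrelatorCertificateAffine`). Modulo the tree's named fact `lieb_wu` (Lieb–Wu 1968: the
energy density of the half-filled chain is the Bethe-ansatz value `liebWuEnergy`, whose rigour status
is recorded at `lieb_wu`), `e(1,·) = liebWuEnergy` on `(0, ∞)`, which is differentiable with
derivative the Lieb–Wu double occupancy
`d(U) = 2 ∫₀^∞ J₀ J₁ e^{ωU/2} / (1 + e^{ωU/2})² dω` (`hasDerivAt_liebWuEnergy`,
`LiebWuEnergyDerivative`). A supergradient of a function differentiable at `U` is its derivative, so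

* `IsTorusLimitOf.re_expect_docc_eq_liebWuDoubleOccupancy`: **`Re ω(n_{0↑} n_{0↓}) = d(U)` for
  EVERY torus-limit half-filled chain ground state** (in particular all of them share one value);
* `hasDerivAt_hubbardChainEnergyDensity_one`: `e(1,·)` is differentiable on `(0,∞)` with
  derivative `d(U)`;
* `liebWuDoubleOccupancy_mem_Icc_of_forall_isTorusLimitOf`: certified lower/upper bounds on the
  double occupancy of torus-limit ground states (the bundle `pub-mbboot`'s chain correlator rows,
  format `certsdp/1` §6–§7, typed as statements over torus-limit ground states with the energy
  hypothesis `e(1,U) ≤ u`) are certified bounds on the exact Bethe-ansatz number `d(U)` — the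
  calibration statement of those rows, inside the tree and modulo `lieb_wu` only.

Everything here is PROVED (conditional theorems take `lieb_wu` as an explicit hypothesis); no
definition, no named fact.

## References
* E. H. Lieb, F. Y. Wu, Phys. Rev. Lett. 20 (1968) 1445, eq. (20). [cite: LiebWuPRL1968, eq. (20)]
* T. Koma, H. Tasaki, J. Stat. Phys. 76 (1994) 745, §1 (order parameters as one-sided derivatives
  of the ground-state energy density). [cite: KomaTasaki1994, §1]
-/

noncomputable section

namespace Literature.MathematicalPhysics.QuantumLattice

open Matrix Finset Filter _root_.Topology HubbardWave0 Literature.Probability.LatticeModels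
open Literature.Analysis.FunctionSpaces
open scoped ComplexOrder

/-- A supergradient of a real function at a point of differentiability is the derivative:
if `f(U') − f(U) ≤ (U' − U)·D` near `U` and `f` has derivative `f'` at `U`, then `D = f'`.
[folklore] -/
private theorem eq_of_hasDerivAt_of_sub_le_mul {f : ℝ → ℝ} {f' D U : ℝ} (hf : HasDerivAt f f' U)
    (h : ∀ᶠ U' in 𝓝 U, f U' - f U ≤ (U' - U) * D) : D = f' := by
  rw [hasDerivAt_iff_tendsto_slope] at hf
  have hgt : Tendsto (slope f U) (𝓝[>] U) (𝓝 f') :=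
    hf.mono_left (nhdsWithin_mono _ fun y hy => ne_of_gt hy)
  have hlt : Tendsto (slope f U) (𝓝[<] U) (𝓝 f') :=
    hf.mono_left (nhdsWithin_mono _ fun y hy => ne_of_lt hy)
  have h1 : f' ≤ D := by
    refine le_of_tendsto hgt ?_
    filter_upwards [nhdsWithin_le_nhds h, self_mem_nhdsWithin] with y hy hyU
    have hyU' : 0 < y - U := sub_pos.2 hyU
    rw [slope_def_field, div_le_iff₀ hyU']
    linarith
  have h2 : D ≤ f' := by
    refine ge_of_tendsto hlt ?_
    filter_upwards [nhdsWithin_le_nhds h, self_mem_nhdsWithin] with y hy hyU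
    have hyU' : y - U < 0 := sub_neg.2 hyU
    rw [slope_def_field, le_div_iff_of_neg hyU']
    linarith
  exact le_antisymm h2 h1

/-- **The double occupancy of every torus-limit ground state of the half-filled Hubbard chain is
the `U`-derivative of the Lieb–Wu energy** (`t = 1`, `U > 0`, modulo `lieb_wu`):
`Re ω(n_{0↑} n_{0↓}) = d(U) = 2 ∫₀^∞ J₀ J₁ e^{ωU/2}/(1 + e^{ωU/2})² dω`. Proof: `D_ω` is a
supergradient of `e(1,·)` at `U` (`IsTorusLimitOf.hubbardChainEnergyDensity_sub_le_mul_re_expect_docc`),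
`e(1,·) = liebWuEnergy` on `(0,∞)` (`hubbardChainEnergyDensity_eq_liebWuEnergy`), and `liebWuEnergy`
is differentiable at `U` with derivative `d(U)` (`hasDerivAt_liebWuEnergy`).
[cite: LiebWuPRL1968, eq. (20)] [cite: KomaTasaki1994, §1] -/
theorem InfVolFermionState.IsTorusLimitOf.re_expect_docc_eq_liebWuDoubleOccupancy (hlw : lieb_wu)
    {ω : InfVolFermionState 1} {ψ : ∀ L, Fock (Orb (FermionTorus 1 L))} {Ls : ℕ → ℕ}
    (h : ω.IsTorusLimitOf ψ Ls) (hLs : Tendsto Ls atTop atTop) {U : ℝ} (hU : 0 < U)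
    (hψ : ∀ j, _root_.Literature.MathematicalPhysics.QuantumLattice.IsGroundState
      (hamiltonian (fermionTorusGraph 1 (Ls j)) 1 U) (Ls j) (ψ (Ls j)))
    (h1 : ∀ j, star (ψ (Ls j)) ⬝ᵥ ψ (Ls j) = 1) :
    (ω.expect ({0} : Finset (Site 1))
        (nAt 0 (Finset.mem_singleton_self 0) 0 * nAt 0 (Finset.mem_singleton_self 0) 1)).re =
      liebWuDoubleOccupancy U := by
  have hev : ∀ᶠ U' in 𝓝 U, liebWuEnergy U' - liebWuEnergy U ≤ (U' - U) *
      (ω.expect ({0} : Finset (Site 1))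
        (nAt 0 (Finset.mem_singleton_self 0) 0 * nAt 0 (Finset.mem_singleton_self 0) 1)).re := by
    filter_upwards [Ioi_mem_nhds hU] with U' hU'
    have hU'0 : (0 : ℝ) < U' := hU'
    have hb := h.hubbardChainEnergyDensity_sub_le_mul_re_expect_docc hLs 1 hU.le hU'0.le hψ h1
    rwa [ThermodynamicLimit.hubbardChainEnergyDensity_eq_liebWuEnergy hlw hU'0,
      ThermodynamicLimit.hubbardChainEnergyDensity_eq_liebWuEnergy hlw hU] at hb
  exact eq_of_hasDerivAt_of_sub_le_mul (hasDerivAt_liebWuEnergy hU) hev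

/-- **All torus-limit half-filled chain ground states at `U > 0` have the same double occupancy**
(modulo `lieb_wu`). [cite: LiebWuPRL1968, eq. (20)] -/
theorem InfVolFermionState.IsTorusLimitOf.re_expect_docc_eq_of_isTorusLimitOf (hlw : lieb_wu)
    {ω₁ ω₂ : InfVolFermionState 1} {ψ₁ ψ₂ : ∀ L, Fock (Orb (FermionTorus 1 L))} {Ls₁ Ls₂ : ℕ → ℕ}
    (h₁ : ω₁.IsTorusLimitOf ψ₁ Ls₁) (h₂ : ω₂.IsTorusLimitOf ψ₂ Ls₂)
    (hLs₁ : Tendsto Ls₁ atTop atTop) (hLs₂ : Tendsto Ls₂ atTop atTop) {U : ℝ} (hU : 0 < U)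
    (hψ₁ : ∀ j, _root_.Literature.MathematicalPhysics.QuantumLattice.IsGroundState
      (hamiltonian (fermionTorusGraph 1 (Ls₁ j)) 1 U) (Ls₁ j) (ψ₁ (Ls₁ j)))
    (h1₁ : ∀ j, star (ψ₁ (Ls₁ j)) ⬝ᵥ ψ₁ (Ls₁ j) = 1)
    (hψ₂ : ∀ j, _root_.Literature.MathematicalPhysics.QuantumLattice.IsGroundState
      (hamiltonian (fermionTorusGraph 1 (Ls₂ j)) 1 U) (Ls₂ j) (ψ₂ (Ls₂ j)))
    (h1₂ : ∀ j, star (ψ₂ (Ls₂ j)) ⬝ᵥ ψ₂ (Ls₂ j) = 1) :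
    (ω₁.expect ({0} : Finset (Site 1))
        (nAt 0 (Finset.mem_singleton_self 0) 0 * nAt 0 (Finset.mem_singleton_self 0) 1)).re =
      (ω₂.expect ({0} : Finset (Site 1))
        (nAt 0 (Finset.mem_singleton_self 0) 0 * nAt 0 (Finset.mem_singleton_self 0) 1)).re := by
  rw [h₁.re_expect_docc_eq_liebWuDoubleOccupancy hlw hLs₁ hU hψ₁ h1₁,
    h₂.re_expect_docc_eq_liebWuDoubleOccupancy hlw hLs₂ hU hψ₂ h1₂]

/-- **`e(1,·)` is differentiable on `(0,∞)` with derivative the Lieb–Wu double occupancy**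
(modulo `lieb_wu`): `HasDerivAt (hubbardChainEnergyDensity 1) (d U) U`. [cite: LiebWuPRL1968, eq. (20)] -/
theorem hasDerivAt_hubbardChainEnergyDensity_one (hlw : lieb_wu) {U : ℝ} (hU : 0 < U) :
    HasDerivAt (ThermodynamicLimit.hubbardChainEnergyDensity 1) (liebWuDoubleOccupancy U) U := by
  refine (hasDerivAt_liebWuEnergy hU).congr_of_eventuallyEq ?_
  filter_upwards [Ioi_mem_nhds hU] with U' hU'
  exact ThermodynamicLimit.hubbardChainEnergyDensity_eq_liebWuEnergy hlw hU'

/-- **Certified torus-limit double-occupancy bounds are bounds on the Bethe-ansatz value.** If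
every torus-limit half-filled chain ground state `ω` at `(t, U) = (1, U)`, `U > 0` (limits along
even rings, the hypothesis package of the bundle's chain correlator rows, with the energy hypothesis
`e(1,U) ≤ u`) satisfies `lo ≤ Re ω(n_{0↑}n_{0↓})` resp. `Re ω(n_{0↑}n_{0↓}) ≤ hi`, and `e(1,U) ≤ u`
holds, then `d(U) ∈ [lo, hi]` (modulo `lieb_wu`; such `ω` exist by
`LiebHalfFilled.exists_isTorusLimitOf_groundState_pow`). [cite: LiebWuPRL1968, eq. (20)] -/
theorem liebWuDoubleOccupancy_mem_Icc_of_forall_isTorusLimitOf (hlw : lieb_wu) {U : ℝ} (hU : 0 < U)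
    {u lo hi : ℝ} (hu : ThermodynamicLimit.hubbardChainEnergyDensity 1 U ≤ u)
    (hlo : ∀ (ω : InfVolFermionState 1) (Ls : ℕ → ℕ) (ψ : ∀ L, Fock (Orb (FermionTorus 1 L))),
      Tendsto Ls atTop atTop → (∀ j, Even (Ls j)) →
      (∀ j, _root_.Literature.MathematicalPhysics.QuantumLattice.IsGroundState
        (hamiltonian (fermionTorusGraph 1 (Ls j)) 1 U) (Ls j) (ψ (Ls j))) →
      (∀ j, star (ψ (Ls j)) ⬝ᵥ ψ (Ls j) = 1) → ω.IsTorusLimitOf ψ Ls →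
      ThermodynamicLimit.hubbardChainEnergyDensity 1 U ≤ u →
      lo ≤ (ω.expect ({0} : Finset (Site 1))
        (nAt 0 (Finset.mem_singleton_self 0) 0 * nAt 0 (Finset.mem_singleton_self 0) 1)).re)
    (hhi : ∀ (ω : InfVolFermionState 1) (Ls : ℕ → ℕ) (ψ : ∀ L, Fock (Orb (FermionTorus 1 L))),
      Tendsto Ls atTop atTop → (∀ j, Even (Ls j)) →
      (∀ j, _root_.Literature.MathematicalPhysics.QuantumLattice.IsGroundState
        (hamiltonian (fermionTorusGraph 1 (Ls j)) 1 U) (Ls j) (ψ (Ls j))) →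
      (∀ j, star (ψ (Ls j)) ⬝ᵥ ψ (Ls j) = 1) → ω.IsTorusLimitOf ψ Ls →
      ThermodynamicLimit.hubbardChainEnergyDensity 1 U ≤ u →
      (ω.expect ({0} : Finset (Site 1))
        (nAt 0 (Finset.mem_singleton_self 0) 0 * nAt 0 (Finset.mem_singleton_self 0) 1)).re ≤ hi) :
    liebWuDoubleOccupancy U ∈ Set.Icc lo hi := by
  obtain ⟨Ls, ψ, ω, hLs, hev, hψ, h1, hω⟩ :=
    LiebHalfFilled.exists_isTorusLimitOf_groundState_pow one_pos (one_ne_zero) hU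
  have hψ' : ∀ j, _root_.Literature.MathematicalPhysics.QuantumLattice.IsGroundState
      (hamiltonian (fermionTorusGraph 1 (Ls j)) 1 U) (Ls j) (ψ (Ls j)) := fun j => by
    simpa only [pow_one] using hψ j
  rw [← hω.re_expect_docc_eq_liebWuDoubleOccupancy hlw hLs hU hψ' h1]
  exact ⟨hlo ω Ls ψ hLs hev hψ' h1 hω hu, hhi ω Ls ψ hLs hev hψ' h1 hω hu⟩

/-- The same with the UPPER bound hypothesis in the `λ = -1` shape of the bundle's `…_Dup` rows
(`E ≤ Re ω(-(n_{0↑}n_{0↓}))`, i.e. `Re ω(n_{0↑}n_{0↓}) ≤ -E`): `d(U) ∈ [lo, -E]` (modulo `lieb_wu`).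
[cite: LiebWuPRL1968, eq. (20)] -/
theorem liebWuDoubleOccupancy_mem_Icc_of_forall_isTorusLimitOf_neg (hlw : lieb_wu) {U : ℝ}
    (hU : 0 < U) {u lo E : ℝ} (hu : ThermodynamicLimit.hubbardChainEnergyDensity 1 U ≤ u)
    (hlo : ∀ (ω : InfVolFermionState 1) (Ls : ℕ → ℕ) (ψ : ∀ L, Fock (Orb (FermionTorus 1 L))),
      Tendsto Ls atTop atTop → (∀ j, Even (Ls j)) →
      (∀ j, _root_.Literature.MathematicalPhysics.QuantumLattice.IsGroundState
        (hamiltonian (fermionTorusGraph 1 (Ls j)) 1 U) (Ls j) (ψ (Ls j))) →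
      (∀ j, star (ψ (Ls j)) ⬝ᵥ ψ (Ls j) = 1) → ω.IsTorusLimitOf ψ Ls →
      ThermodynamicLimit.hubbardChainEnergyDensity 1 U ≤ u →
      lo ≤ (ω.expect ({0} : Finset (Site 1))
        (nAt 0 (Finset.mem_singleton_self 0) 0 * nAt 0 (Finset.mem_singleton_self 0) 1)).re)
    (hup : ∀ (ω : InfVolFermionState 1) (Ls : ℕ → ℕ) (ψ : ∀ L, Fock (Orb (FermionTorus 1 L))),
      Tendsto Ls atTop atTop → (∀ j, Even (Ls j)) →
      (∀ j, _root_.Literature.MathematicalPhysics.QuantumLattice.IsGroundState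
        (hamiltonian (fermionTorusGraph 1 (Ls j)) 1 U) (Ls j) (ψ (Ls j))) →
      (∀ j, star (ψ (Ls j)) ⬝ᵥ ψ (Ls j) = 1) → ω.IsTorusLimitOf ψ Ls →
      ThermodynamicLimit.hubbardChainEnergyDensity 1 U ≤ u →
      E ≤ (ω.expect ({0} : Finset (Site 1))
        (-(nAt 0 (Finset.mem_singleton_self 0) 0 * nAt 0 (Finset.mem_singleton_self 0) 1))).re) :
    liebWuDoubleOccupancy U ∈ Set.Icc lo (-E) := by
  refine liebWuDoubleOccupancy_mem_Icc_of_forall_isTorusLimitOf hlw hU hu hlo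
    fun ω Ls ψ hLs hev hψ h1 hω hu' => ?_
  have h := hup ω Ls ψ hLs hev hψ h1 hω hu'
  rw [map_neg, Complex.neg_re] at h
  linarith

end Literature.MathematicalPhysics.QuantumLattice
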